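import Summits.AnomalousDissipation.AnomalousDissipation.Theorems.MomentParityResolvedDissipationStubSmoothCylRow
import Summits.AnomalousDissipation.AnomalousDissipation.Theorems.MomentParityResolvedDissipationStubFgtBound
import Summits.AnomalousDissipation.AnomalousDissipation.Theorems.UniformResolution.Negative.ResolutionCriterion
import Summits.AnomalousDissipation.AnomalousDissipation.Theorems.MomentParityResolvedDissipationInMeasure
import Summits.AnomalousDissipation.AnomalousDissipation.Theorems.QuarticGate.Negative.EnergyRow

/-!
# `MomentParity.ResolvedDissipation` (stmt-AnomalousDissipation-14284), line `enstrophy-ui-transfer`: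
# the REDUCTION — at each `(f, ν, R)`, uniform integrability of the enstrophy implies the crux's conclusion

Supports stmt-AnomalousDissipation-14284 (helper of the line lead; nothing here closes an item).

With the two infrastructure stubs of the line landed (`…StubSmoothCylRow`: smooth cylindrical rows of admissible
laws; `…StubFgtBound`: the FGT weighted `H²` bound from one row) and the landed resolution criterion
(`Theorems/UniformResolution/Negative/ResolutionCriterion.lean`), the composition of the line is a theorem WITHOUT
the hard stub as a global hypothesis: pointwise in `(f, ν, R)`,

  `resolvedDissipation_of_uniformIntegrability` :  UI(f, ν, R) → (∃ κ, every admissible law at `(f, ν, R)` is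
  `κ`-resolved)  — the body of `ResolvedDissipation` at `(f, ν, R)`.

Together with the landed converse (`…Converse.lean`, `uniformlyIntegrableEnstrophy_of_resolved`) this certifies
`ResolvedDissipation ⟺ ∀ (f, ν, R), UI(f, ν, R)` in the tree; with `…SmallData.lean` it proves the crux's conclusion
for every force in the laminar regime `∫‖f‖² ≤ ν⁴/16` (`resolvedDissipation_smallForce`, there).

* `fgtRow_of_smoothCylRow` — the FGT row `(1+Z_N)⁻⁴⟨F(u), A P_N u⟩` of an admissible law vanishes (instance
  `Ψ(e,z) = -(1+z)⁻³/6` of the smooth cylindrical row);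
* `weightedH2Bound_admissible` — `WeightedH2Bound 4` for the admissible family at `(f, ν, R)`;
* `resolvedDissipation_of_uniformIntegrability` — the reduction;
* `ensembleEnstrophy_le_budget` — the `N`-uniform budget `∫‖∇u‖² dμ ≤ ‖f‖₂R/ν` (energy row + Cauchy–Schwarz);
* `exists_schedule_resolvedInMeasure_admissible` — UNCONDITIONALLY, one schedule resolves the enstrophy of every
  admissible law at `(f, ν, R)` IN MEASURE, uniformly in `N` (landed `exists_schedule_resolvedInMeasure` + the two bounds).
-/

noncomputable section

-- `Summit.<Summit>.<Problem>`: single-conjunct summit, the duplicate namespace segment is mandated.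
set_option linter.dupNamespace false

namespace Summit.AnomalousDissipation.AnomalousDissipation.Theorems.MomentParityResolvedDissipation

open MeasureTheory Filter Topology
open scoped ENNReal InnerProductSpace RealInnerProductSpace
open Literature.Analysis.FunctionSpaces Literature.Analysis.FluidPDE
open Summit.AnomalousDissipation.AnomalousDissipation.Theses.MomentParity
open Summit.AnomalousDissipation.AnomalousDissipation.Theorems.CubicParityLoud.Negative (T3 R3 H3 L2T3)
open Summit.AnomalousDissipation.AnomalousDissipation.Theorems.QuarticGate.Negative
  (IsLevel IsBandTest polyGrad IsPolyStationary)
open Summit.AnomalousDissipation.AnomalousDissipation.Theorems.UniformResolution.Negative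
  (eLapNormSq UniformlyIntegrableEnstrophy WeightedH2Bound
    exists_isResolved_of_uniformlyIntegrable_of_weightedH2)

/-! ## The FGT row from the smooth cylindrical row -/

/-- The one-variable FGT profile `t ↦ -(1+t)⁻³/6` has derivative `½(1+t)⁻⁴` on `t > -1`. [folklore] -/
theorem hasDerivAt_fgtProfile₁ {z : ℝ} (hz : -1 < z) :
    HasDerivAt (fun t : ℝ => -((1 + t) ^ 3)⁻¹ / 6) (2⁻¹ * ((1 + z) ^ 4)⁻¹) z := by
  have hz1 : (0 : ℝ) < 1 + z := by linarith
  have h1 : HasDerivAt (fun t : ℝ => 1 + t) 1 z := (hasDerivAt_id z).const_add 1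
  have h2 : HasDerivAt (fun t : ℝ => (1 + t) ^ 3) ((3 : ℕ) * (1 + z) ^ (3 - 1) * 1) z := h1.pow 3
  have h3 : HasDerivAt (fun t : ℝ => ((1 + t) ^ 3)⁻¹)
      (-((3 : ℕ) * (1 + z) ^ (3 - 1) * 1) / ((1 + z) ^ 3) ^ 2) z := h2.inv (by positivity)
  have h4 : HasDerivAt (fun t : ℝ => -((1 + t) ^ 3)⁻¹)
      (-(-((3 : ℕ) * (1 + z) ^ (3 - 1) * 1) / ((1 + z) ^ 3) ^ 2)) z := HasDerivAt.neg h3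
  have h5 : HasDerivAt (fun t : ℝ => -((1 + t) ^ 3)⁻¹ / 6)
      (-(-((3 : ℕ) * (1 + z) ^ (3 - 1) * 1) / ((1 + z) ^ 3) ^ 2) / 6) z := HasDerivAt.div_const h4 6
  refine h5.congr_deriv ?_
  push_cast
  field_simp
  ring

/-- The FGT profile `Ψ(e,z) = -(1+z)⁻³/6` is `C¹` on `ℝ × (-1, ∞)`. [folklore] -/
theorem fgtProfile_contDiffOn :
    ContDiffOn ℝ 1 (fun p : ℝ × ℝ => -((1 + p.2) ^ 3)⁻¹ / 6) ((Set.univ : Set ℝ) ×ˢ Set.Ioi (-1 : ℝ)) := by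
  intro p hp
  have hz : 0 < 1 + p.2 := by
    have := hp.2
    simp only [Set.mem_Ioi] at this
    linarith
  refine (ContDiffAt.contDiffWithinAt ?_)
  have h1 : ContDiffAt ℝ 1 (fun p : ℝ × ℝ => (1 + p.2) ^ 3) p :=
    (contDiffAt_const.add contDiffAt_snd).pow 3
  exact ((h1.inv (by positivity)).neg).div_const 6

/-- The partial derivatives of the FGT profile on `z > -1`: `∂₁Ψ = 0`, `∂₂Ψ = ½(1+z)⁻⁴`. [folklore] -/
theorem fderiv_fgtProfile {e z : ℝ} (hz : -1 < z) :
    fderiv ℝ (fun p : ℝ × ℝ => -((1 + p.2) ^ 3)⁻¹ / 6) (e, z) (1, 0) = 0 ∧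
    fderiv ℝ (fun p : ℝ × ℝ => -((1 + p.2) ^ 3)⁻¹ / 6) (e, z) (0, 1) = 2⁻¹ * ((1 + z) ^ 4)⁻¹ := by
  have hG : HasFDerivAt ((fun t : ℝ => -((1 + t) ^ 3)⁻¹ / 6) ∘ Prod.snd)
      ((ContinuousLinearMap.smulRight (1 : ℝ →L[ℝ] ℝ) (2⁻¹ * ((1 + z) ^ 4)⁻¹)).comp
        (ContinuousLinearMap.snd ℝ ℝ ℝ)) (e, z) :=
    (hasDerivAt_fgtProfile₁ hz).hasFDerivAt.comp (e, z) hasFDerivAt_snd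
  have e1 : (fun p : ℝ × ℝ => -((1 + p.2) ^ 3)⁻¹ / 6) =
      (fun t : ℝ => -((1 + t) ^ 3)⁻¹ / 6) ∘ Prod.snd := rfl
  rw [e1, hG.fderiv]
  refine ⟨?_, ?_⟩
  · simp
  · simp

/-- **The FGT row of an admissible law vanishes** (integrable row, zero mean): instance `Ψ(e,z) = -(1+z)⁻³/6`
of the landed smooth cylindrical row `CylRow.stub_smoothCylRow` on `U = ℝ × (-1, ∞)`. [folklore] -/
theorem fgtRow_of_smoothCylRow {ν : ℝ} {f : T3 → R3} (hf : Torus.IsSmooth f) {N : ℕ} {R : ℝ}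
    {μ : Measure H3} (hP : IsProbabilityMeasure μ) (hL : ∀ᵐ u ∂μ, IsLevel N u) (hB : ∀ᵐ u ∂μ, ‖u‖ ≤ R)
    (hS : ∀ d : ℕ, IsPolyStationary ν f N d μ) :
    Integrable (fun u : H3 =>
        ((1 + 4 * Real.pi ^ 2 * ∑ k ∈ Torus.freqBall N, Torus.freqNormSq k *
            ‖UnitAddTorus.mFourierCoeff (EuclideanSpace.complexify ∘ (u.1 : T3 → R3)) k‖ ^ 2) ^ 4)⁻¹ *
          Torus.nsGeneratorPairing ν f u (Torus.realTrigPoly (Torus.freqBall N) fun k =>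
            (((4 * Real.pi ^ 2 * Torus.freqNormSq k : ℝ)) : ℂ) •
              UnitAddTorus.mFourierCoeff (EuclideanSpace.complexify ∘ (u.1 : T3 → R3)) k)) μ ∧
      ∫ u, ((1 + 4 * Real.pi ^ 2 * ∑ k ∈ Torus.freqBall N, Torus.freqNormSq k *
            ‖UnitAddTorus.mFourierCoeff (EuclideanSpace.complexify ∘ (u.1 : T3 → R3)) k‖ ^ 2) ^ 4)⁻¹ *
          Torus.nsGeneratorPairing ν f u (Torus.realTrigPoly (Torus.freqBall N) fun k =>
            (((4 * Real.pi ^ 2 * Torus.freqNormSq k : ℝ)) : ℂ) •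
              UnitAddTorus.mFourierCoeff (EuclideanSpace.complexify ∘ (u.1 : T3 → R3)) k) ∂μ = 0 := by
  have hU : IsOpen ((Set.univ : Set ℝ) ×ˢ Set.Ioi (-1 : ℝ)) := isOpen_univ.prod isOpen_Ioi
  have hsub : Set.Ici (0 : ℝ) ×ˢ Set.Ici (0 : ℝ) ⊆ (Set.univ : Set ℝ) ×ˢ Set.Ioi (-1 : ℝ) := by
    rintro ⟨a, b⟩ ⟨-, hb⟩
    refine ⟨Set.mem_univ _, ?_⟩
    simp only [Set.mem_Ici] at hb
    simp only [Set.mem_Ioi]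
    linarith
  obtain ⟨hI, h0⟩ := CylRow.stub_smoothCylRow ν f hf N R μ hP hL hB hS _ _ hU hsub fgtProfile_contDiffOn
  have hnn : ∀ u : H3, (0 : ℝ) ≤ 4 * Real.pi ^ 2 * ∑ k ∈ Torus.freqBall N, Torus.freqNormSq k *
      ‖UnitAddTorus.mFourierCoeff (EuclideanSpace.complexify ∘ (u.1 : T3 → R3)) k‖ ^ 2 := fun u =>
    mul_nonneg (by positivity) (Finset.sum_nonneg fun k _ =>
      mul_nonneg (Torus.freqNormSq_nonneg _) (sq_nonneg _))
  have hpt : ∀ u : H3,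
      2 * fderiv ℝ (fun p : ℝ × ℝ => -((1 + p.2) ^ 3)⁻¹ / 6)
            (‖u‖ ^ 2, 4 * Real.pi ^ 2 * ∑ k ∈ Torus.freqBall N, Torus.freqNormSq k *
              ‖UnitAddTorus.mFourierCoeff (EuclideanSpace.complexify ∘ (u.1 : T3 → R3)) k‖ ^ 2) (1, 0) *
            Torus.nsGeneratorPairing ν f u (Torus.fourierTruncate N (u.1 : T3 → R3)) +
          2 * fderiv ℝ (fun p : ℝ × ℝ => -((1 + p.2) ^ 3)⁻¹ / 6)
            (‖u‖ ^ 2, 4 * Real.pi ^ 2 * ∑ k ∈ Torus.freqBall N, Torus.freqNormSq k *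
              ‖UnitAddTorus.mFourierCoeff (EuclideanSpace.complexify ∘ (u.1 : T3 → R3)) k‖ ^ 2) (0, 1) *
            Torus.nsGeneratorPairing ν f u (Torus.realTrigPoly (Torus.freqBall N) fun k =>
              (((4 * Real.pi ^ 2 * Torus.freqNormSq k : ℝ)) : ℂ) •
                UnitAddTorus.mFourierCoeff (EuclideanSpace.complexify ∘ (u.1 : T3 → R3)) k) =
      ((1 + 4 * Real.pi ^ 2 * ∑ k ∈ Torus.freqBall N, Torus.freqNormSq k *
            ‖UnitAddTorus.mFourierCoeff (EuclideanSpace.complexify ∘ (u.1 : T3 → R3)) k‖ ^ 2) ^ 4)⁻¹ *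
          Torus.nsGeneratorPairing ν f u (Torus.realTrigPoly (Torus.freqBall N) fun k =>
            (((4 * Real.pi ^ 2 * Torus.freqNormSq k : ℝ)) : ℂ) •
              UnitAddTorus.mFourierCoeff (EuclideanSpace.complexify ∘ (u.1 : T3 → R3)) k) := by
    intro u
    obtain ⟨h1, h2⟩ := fderiv_fgtProfile (e := ‖u‖ ^ 2)
      (lt_of_lt_of_le (by norm_num : (-1 : ℝ) < 0) (hnn u))
    rw [h1, h2]
    ring
  refine ⟨hI.congr (ae_of_all _ fun u => hpt u), ?_⟩
  rw [← integral_congr_ae (ae_of_all _ fun u => hpt u)]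
  exact h0

/-- **`WeightedH2Bound 4` for the admissible family at `(f, ν, R)`** (smooth cylindrical row + FGT bound, both
landed stubs of the line). [folklore] -/
theorem weightedH2Bound_admissible {ν : ℝ} (hν : 0 < ν) {f : T3 → R3} (hf : Torus.IsSmooth f) (R : ℝ) :
    WeightedH2Bound 4 {μ : Measure H3 | IsProbabilityMeasure μ ∧ ∃ N : ℕ,
      (∀ᵐ u ∂μ, IsLevel N u) ∧ (∀ᵐ u ∂μ, ‖u‖ ≤ R) ∧ ∀ d : ℕ, IsPolyStationary ν f N d μ} := by
  obtain ⟨C, hC⟩ := FGT.stub_fgtBound ν f hν hf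
  refine ⟨ENNReal.ofReal C, ENNReal.ofReal_ne_top, fun μ hμ => ?_⟩
  obtain ⟨hP, N, hL, hB, hS⟩ := hμ
  obtain ⟨hI, h0⟩ := fgtRow_of_smoothCylRow hf hP hL hB hS
  exact hC N R μ hP hL hB hI h0

/-! ## The reduction -/

/-- **THE REDUCTION of the crux to uniform integrability, pointwise in `(f, ν, R)`.** Let `f` be smooth, `ν > 0`,
`R` real. If the enstrophy is uniformly integrable over the admissible family at `(f, ν, R)` — for every `ε > 0` ONE
level `M < ∞` such that every probability law on `H` carried by level-`N` fields, supported in `‖u‖ ≤ R` and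
stationary for Galerkin NS at `(ν, f)` at every polynomial order has `∫_{‖∇u‖² > M}‖∇u‖² dμ ≤ ε`, for every `N` —
then ONE schedule `κ` resolves the mean enstrophy of every such law at every level:
`∫‖∇u‖² dμ ≤ ∫‖∇P_{κ n}u‖² dμ + 1/(n+1)` for all `n` (the conclusion of `ResolvedDissipation` at `(f, ν, R)`).
Proof: the landed resolution criterion with `UniformlyIntegrableEnstrophy` = the hypothesis and `WeightedH2Bound 4` =
`weightedH2Bound_admissible`. With the converse `uniformlyIntegrableEnstrophy_of_resolved` (`…Converse.lean`) the
two statements are EQUIVALENT at each `(f, ν, R)`. [folklore] -/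
theorem resolvedDissipation_of_uniformIntegrability :
    ∀ (f : T3 → R3), Torus.IsSmooth f → ∀ (ν : ℝ), 0 < ν → ∀ (R : ℝ),
    (∀ ε : ℝ≥0∞, 0 < ε → ∃ M : ℝ≥0∞, M ≠ ⊤ ∧
        ∀ (N : ℕ) (μ : Measure (Torus.energySpace (Fin 3))), IsProbabilityMeasure μ →
          (∀ᵐ u ∂μ, IsLevel N u) → (∀ᵐ u ∂μ, ‖u‖ ≤ R) → (∀ d : ℕ, IsPolyStationary ν f N d μ) →
          ∫⁻ u in {u : Torus.energySpace (Fin 3) |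
              M < Torus.eGradNormSq (u.1 : UnitAddTorus (Fin 3) → EuclideanSpace ℝ (Fin 3))},
            Torus.eGradNormSq (u.1 : UnitAddTorus (Fin 3) → EuclideanSpace ℝ (Fin 3)) ∂μ ≤ ε) →
    ∃ κ : ℕ → ℕ, ∀ (N : ℕ) (μ : Measure (Torus.energySpace (Fin 3))), IsProbabilityMeasure μ →
      (∀ᵐ u ∂μ, IsLevel N u) → (∀ᵐ u ∂μ, ‖u‖ ≤ R) → (∀ d : ℕ, IsPolyStationary ν f N d μ) →
      ∀ n : ℕ, ∫⁻ u, Torus.eGradNormSq (u.1 : UnitAddTorus (Fin 3) → EuclideanSpace ℝ (Fin 3)) ∂μ ≤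
        (∫⁻ u, Torus.eGradNormSq (Torus.fourierTruncate (κ n)
          (u.1 : UnitAddTorus (Fin 3) → EuclideanSpace ℝ (Fin 3))) ∂μ) + ((n : ℝ≥0∞) + 1)⁻¹ := by
  intro f hf ν hν R hUI0
  have hUI : UniformlyIntegrableEnstrophy {μ : Measure H3 | IsProbabilityMeasure μ ∧ ∃ N : ℕ,
      (∀ᵐ u ∂μ, IsLevel N u) ∧ (∀ᵐ u ∂μ, ‖u‖ ≤ R) ∧ ∀ d : ℕ, IsPolyStationary ν f N d μ} := by
    intro η hη
    obtain ⟨M, hM, hUI⟩ := hUI0 η hη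
    refine ⟨M, hM, fun μ hμ => ?_⟩
    obtain ⟨hp, N, hl, hb, hs⟩ := hμ
    exact hUI N μ hp hl hb hs
  obtain ⟨κ, hκ⟩ := exists_isResolved_of_uniformlyIntegrable_of_weightedH2 hUI
    (weightedH2Bound_admissible hν hf R)
  exact ⟨κ, fun N μ hp hl hb hs n => hκ μ ⟨hp, N, hl, hb, hs⟩ n⟩

/-! ## The `N`-uniform enstrophy budget and resolution in measure for the admissible family -/

/-- **The `N`-uniform enstrophy budget of admissible laws**: `∫⁻ ‖∇u‖² dμ ≤ ‖f‖₂ R / ν` for every admissible law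
at `(f, ν, R)` at any level `N` (energy row `ν∫‖∇u‖² = ∫(u,f)` from 3-stationarity, Cauchy–Schwarz, `‖u‖ ≤ R`).
Proof adapted from the planner's skeleton `Cruxes/ResolvedDissipation/Lines/lions_l4_domination.lean`. [folklore] -/
theorem ensembleEnstrophy_le_budget {ν : ℝ} (hν : 0 < ν)
    {f : T3 → R3} (hf : MemLp f 2 volume) {N : ℕ}
    {μ : Measure H3} (hp : IsProbabilityMeasure μ)
    (hlev : ∀ᵐ u ∂μ, IsLevel N u) {R : ℝ} (hR : ∀ᵐ u ∂μ, ‖u‖ ≤ R)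
    (hstat : ∀ d : ℕ, IsPolyStationary ν f N d μ) :
    Torus.ensembleEnstrophy μ ≤ ENNReal.ofReal (Real.sqrt (∫ x, ‖f x‖ ^ 2) * R / ν) := by
  -- adapted from Cruxes/ResolvedDissipation/Lines/lions_l4_domination.lean (planner-cruxplan-…-lions-l4-domination-0)
  haveI : (ae μ).NeBot := ae_neBot.2 (IsProbabilityMeasure.ne_zero μ)
  obtain ⟨u₀, hu₀⟩ := hR.exists
  have hR0 : 0 ≤ R := (norm_nonneg _).trans hu₀
  have h2 : Integrable (fun u : H3 => ‖u‖ ^ 2) μ :=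
    Integrable.of_bound (continuous_norm.pow 2).aestronglyMeasurable (R ^ 2) (hR.mono fun u hu => by
      rw [Real.norm_eq_abs, abs_of_nonneg (by positivity)]
      exact pow_le_pow_left₀ (norm_nonneg _) hu 2)
  have hE : Torus.ensembleEnergy μ ≤ R ^ 2 := by
    unfold Torus.ensembleEnergy
    calc ∫ u, ‖u‖ ^ 2 ∂μ ≤ ∫ _u, R ^ 2 ∂μ := integral_mono_ae h2 (integrable_const _)
          (hR.mono fun u hu => pow_le_pow_left₀ (norm_nonneg _) hu 2)
      _ = R ^ 2 := by simp
  have hdiss : Torus.ensembleDissipation ν μ ≤ Real.sqrt (∫ x, ‖f x‖ ^ 2) * R := by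
    rw [QuarticGate.Negative.ensembleDissipation_eq_of_polyStationary f hf hlev h2 le_rfl (hstat 3)]
    refine (Summit.AnomalousDissipation.AnomalousDissipation.Theorems.CubicParityLoud.Negative.integral_pairing_le
      hf h2).trans ?_
    gcongr
    calc Real.sqrt (Torus.ensembleEnergy μ) ≤ Real.sqrt (R ^ 2) := Real.sqrt_le_sqrt hE
      _ = R := Real.sqrt_sq hR0
  have hne : Torus.ensembleEnstrophy μ ≠ ⊤ := by
    have h1 := QuarticGate.Negative.ensembleEnstrophy_le_of_level hlev
    have h3 : ∫⁻ u : H3, ‖u‖ₑ ^ 2 ∂μ ≤ ∫⁻ _u : H3, ENNReal.ofReal (R ^ 2) ∂μ :=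
      lintegral_mono_ae (hR.mono fun u hu => by
        rw [← ofReal_norm, ← ENNReal.ofReal_pow (norm_nonneg _)]
        exact ENNReal.ofReal_le_ofReal (pow_le_pow_left₀ (norm_nonneg _) hu 2))
    rw [lintegral_const, measure_univ, mul_one] at h3
    exact ne_top_of_le_ne_top
      (ENNReal.mul_ne_top ENNReal.ofReal_ne_top (ne_top_of_le_ne_top ENNReal.ofReal_ne_top h3)) h1
  unfold Torus.ensembleDissipation at hdiss
  rw [← ENNReal.ofReal_toReal hne]
  refine ENNReal.ofReal_le_ofReal ?_
  rw [le_div_iff₀ hν, mul_comm]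
  exact hdiss

/-- **RESOLUTION IN MEASURE for the admissible family, unconditionally and uniformly in `N`.** For every smooth `f`,
`ν > 0` and `R` there is ONE schedule `κ` such that every probability law on `H` carried by level-`N` fields, supported in
`‖u‖ ≤ R` and stationary for Galerkin NS at `(ν, f)` at every polynomial order satisfies, for all `n` and all `N`,
`μ {u : tail_{κ n}(u) > 1/(n+1)} ≤ 1/(n+1)` (`tail_K = ‖∇u‖² − ‖∇P_K u‖²`). The crux asks for the same IN MEAN, which is
exactly uniform integrability of `‖∇u‖²` (`resolvedDissipation_of_uniformIntegrability` + the converse). [folklore] -/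
theorem exists_schedule_resolvedInMeasure_admissible :
    ∀ (f : T3 → R3), Torus.IsSmooth f → ∀ (ν : ℝ), 0 < ν → ∀ (R : ℝ),
    ∃ κ : ℕ → ℕ, ∀ (N : ℕ) (μ : Measure H3), IsProbabilityMeasure μ →
      (∀ᵐ u ∂μ, IsLevel N u) → (∀ᵐ u ∂μ, ‖u‖ ≤ R) → (∀ d : ℕ, IsPolyStationary ν f N d μ) →
      ∀ n : ℕ, μ {u : H3 | ((n : ℝ≥0∞) + 1)⁻¹ < Torus.tailGradNormSq (κ n) (u.1 : T3 → R3)} ≤ ((n : ℝ≥0∞) + 1)⁻¹ := by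
  intro f hf ν hν R
  obtain ⟨κ, hκ⟩ := exists_schedule_resolvedInMeasure
    {μ : Measure H3 | IsProbabilityMeasure μ ∧ ∃ N : ℕ,
      (∀ᵐ u ∂μ, IsLevel N u) ∧ (∀ᵐ u ∂μ, ‖u‖ ≤ R) ∧ ∀ d : ℕ, IsPolyStationary ν f N d μ} 4
    (ENNReal.ofReal (Real.sqrt (∫ x, ‖f x‖ ^ 2) * R / ν)) (weightedH2Bound_admissible hν hf R)
    ENNReal.ofReal_ne_top (fun μ hμ => by
      obtain ⟨hp, N, hl, hb, hs⟩ := hμ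
      exact ensembleEnstrophy_le_budget hν (hf.memLp 2) hp hl hb hs)
  exact ⟨κ, fun N μ hp hl hb hs n => hκ μ ⟨hp, N, hl, hb, hs⟩ n⟩

end Summit.AnomalousDissipation.AnomalousDissipation.Theorems.MomentParityResolvedDissipation

end
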